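import Summits.QuantumFields.YangMills.Theorems.LangevinControlUVOSLegsAtWeakCouplingCStubLocalityGaps
import Literature.Analysis.Complex.LogSectorExtension
import HarnessLib

/-!
# Chambers of configurations: gaps for fixed orderings, complexification (E1-locality — file D1)

Helper file for stub `stub_locality` of crux `OSLegsAtWeakCouplingC` (stmt-QuantumFields-16207, line `Sketch`,
continuation lead c2).  The identity-theorem step of the locality proof compares the product-bump function at a
configuration `w` and at its image `R ∘ w` through the holomorphic extensions of file C2 in the gap coordinates of
`w` (orderings `σ`) and of `R ∘ w` (orderings `σ'`).  This file is the bookkeeping: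

* `isOpen_sectorRegion`, `ofReal_mem_sectorRegion` — the sector region of the engine is open and contains the
  positive real points;
* `toE` (coordinate arrays → configurations), `gapsOf σ ε w` (the consecutive gaps of `w` along the orderings `σ`,
  minus the base gap `ε`; affine and continuous in `w`), the telescoping identity `conf_gapsOf`
  (`conf ε σ (gapsOf σ ε w)` IS `w` up to a translation) and the separation consequences of non-negative gaps;
* `gapsOfC`, `rotC` — the same affine gaps and the action of the isometry `R` (through its real matrix) on COMPLEX
  coordinate arrays: holomorphic, and equal to the real objects at real points (`gapsOfC_ofReal`, `rotC_ofReal`).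
-/

set_option autoImplicit false

noncomputable section

namespace Summit.QuantumFields.YangMills.Theorems.OSLegsAtWeakCouplingC.Loc

open scoped BigOperators ComplexConjugate SchwartzMap
open Filter Topology
open Literature.MathematicalPhysics.QuantumLattice Literature.MathematicalPhysics.AQFT
open Literature.Analysis.Complex (sectorRegion)

variable {q : ℕ}

/-! ### The sector region is open -/

/-- The sector region `{Re wⱼ > 0, Σⱼ |arg wⱼ| < c}` is open (the argument is continuous off the closed negative
real axis). -/
theorem isOpen_sectorRegion (K : ℕ) (c : ℝ) : IsOpen (sectorRegion K c) := by
  rw [isOpen_iff_mem_nhds]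
  intro w hw
  obtain ⟨hre, harg⟩ := hw
  have h1 : {w : Fin (K + 1) → ℂ | ∀ j, 0 < (w j).re} ∈ 𝓝 w := by
    have hopen : IsOpen {w : Fin (K + 1) → ℂ | ∀ j, 0 < (w j).re} := by
      simp only [Set.setOf_forall]
      exact isOpen_iInter_of_finite fun j => isOpen_lt continuous_const (Complex.continuous_re.comp (continuous_apply j))
    exact hopen.mem_nhds hre
  have h2 : ContinuousAt (fun w : Fin (K + 1) → ℂ => ∑ j, |Complex.arg (w j)|) w := by
    refine tendsto_finsetSum _ fun j _ => ?_
    have hslit : w j ∈ Complex.slitPlane := Or.inl (hre j)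
    have hg : ContinuousAt (fun z : ℂ => |Complex.arg z|) (w j) :=
      (continuous_abs.continuousAt).comp (Complex.continuousAt_arg hslit)
    exact hg.comp (f := fun p : Fin (K + 1) → ℂ => p j) (continuous_apply j).continuousAt
  have h3 : {w : Fin (K + 1) → ℂ | ∑ j, |Complex.arg (w j)| < c} ∈ 𝓝 w :=
    h2.preimage_mem_nhds (isOpen_Iio.mem_nhds harg)
  filter_upwards [h1, h3] with w' hw1 hw3
  exact ⟨hw1, hw3⟩

/-- A vector of positive reals lies in the sector region of any positive opening. -/
theorem ofReal_mem_sectorRegion {K : ℕ} {c : ℝ} (hc : 0 < c) {u : Fin (K + 1) → ℝ} (hu : ∀ j, 0 < u j) :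
    (fun j => ((u j : ℝ) : ℂ)) ∈ sectorRegion K c := by
  refine ⟨fun j => by simpa using hu j, ?_⟩
  have : ∀ j, |Complex.arg ((u j : ℝ) : ℂ)| = 0 := fun j => by
    rw [Complex.arg_ofReal_of_nonneg (hu j).le, abs_zero]
  simp [this, hc]

/-! ### Coordinates of configurations -/

/-- Configurations from coordinate arrays. -/
def toE (w : Fin (q + 2) → Fin 4 → ℝ) (i : Fin (q + 2)) : EuclideanSpace ℝ (Fin 4) := WithLp.toLp 2 (w i)

/-- Coordinates of `toE`. -/
@[simp] theorem toE_apply (w : Fin (q + 2) → Fin 4 → ℝ) (i : Fin (q + 2)) (μ : Fin 4) : toE w i μ = w i μ := rfl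

/-- `toE` of the coordinate array of a configuration. -/
@[simp] theorem toE_coords (c : Fin (q + 2) → EuclideanSpace ℝ (Fin 4)) : toE (fun i μ => c i μ) = c := rfl

/-- `toE` is affine (indeed linear). -/
theorem toE_add_smul (a b : ℝ) (w w' : Fin (q + 2) → Fin 4 → ℝ) (i : Fin (q + 2)) :
    toE (a • w + b • w') i = a • toE w i + b • toE w' i := by
  ext μ; simp [toE]

/-- The Euclidean norm on `ℝ⁴` is at most twice the largest coordinate. -/
theorem norm_le_two_mul {x : EuclideanSpace ℝ (Fin 4)} {s : ℝ} (hs : 0 ≤ s) (h : ∀ μ, |x μ| ≤ s) : ‖x‖ ≤ 2 * s := by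
  rw [EuclideanSpace.norm_eq]
  have h1 : ∑ μ : Fin 4, ‖x μ‖ ^ 2 ≤ 4 * s ^ 2 := by
    have : ∀ μ : Fin 4, ‖x μ‖ ^ 2 ≤ s ^ 2 := fun μ => by
      rw [Real.norm_eq_abs]; exact pow_le_pow_left₀ (abs_nonneg _) (h μ) 2
    calc ∑ μ : Fin 4, ‖x μ‖ ^ 2 ≤ ∑ _μ : Fin 4, s ^ 2 := Finset.sum_le_sum fun μ _ => this μ
      _ = 4 * s ^ 2 := by simp
  calc Real.sqrt (∑ μ : Fin 4, ‖x μ‖ ^ 2) ≤ Real.sqrt (4 * s ^ 2) := Real.sqrt_le_sqrt h1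
    _ = 2 * s := by
        rw [show (4 : ℝ) * s ^ 2 = (2 * s) ^ 2 by ring, Real.sqrt_sq (by positivity)]

/-! ### Gaps of a configuration with respect to fixed orderings -/

/-- **The gaps of the coordinate array `w` with respect to the orderings `σ`**, minus the base gap `ε`:
`gapsOf σ ε w (μ, p) = w_{σ μ (p+1), μ} − w_{σ μ p, μ} − ε`. -/
def gapsOf (σ : Fin 4 → Equiv.Perm (Fin (q + 2))) (ε : ℝ) (w : Fin (q + 2) → Fin 4 → ℝ) (j : Fin (4 * q + 3 + 1)) : ℝ :=
  w (σ (gapEquiv q j).1 (gapEquiv q j).2.succ) (gapEquiv q j).1 -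
    w (σ (gapEquiv q j).1 (Fin.castSucc (gapEquiv q j).2)) (gapEquiv q j).1 - ε

/-- The gaps at a gap index `(μ, g)`. -/
theorem gapsOf_gidx (σ : Fin 4 → Equiv.Perm (Fin (q + 2))) (ε : ℝ) (w : Fin (q + 2) → Fin 4 → ℝ) (μ : Fin 4)
    (g : Fin (q + 1)) : gapsOf σ ε w (gidx q μ g) = w (σ μ g.succ) μ - w (σ μ (Fin.castSucc g)) μ - ε := by
  simp [gapsOf]

/-- The gaps are affine in the configuration. -/
theorem gapsOf_add_smul (σ : Fin 4 → Equiv.Perm (Fin (q + 2))) (ε : ℝ) {a b : ℝ} (hab : a + b = 1)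
    (w w' : Fin (q + 2) → Fin 4 → ℝ) (j : Fin (4 * q + 3 + 1)) :
    gapsOf σ ε (a • w + b • w') j = a * gapsOf σ ε w j + b * gapsOf σ ε w' j := by
  simp only [gapsOf, Pi.add_apply, Pi.smul_apply, smul_eq_mul]
  linear_combination ε * hab

/-- Continuity of the gaps in the configuration. -/
theorem continuous_gapsOf (σ : Fin 4 → Equiv.Perm (Fin (q + 2))) (ε : ℝ) :
    Continuous fun w : Fin (q + 2) → Fin 4 → ℝ => gapsOf σ ε w := by
  refine continuous_pi fun j => ?_
  simp only [gapsOf]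
  fun_prop

/-- **Telescoping**: the cumulative coordinates of the gaps of `w` are the coordinates of `w` relative to the
lowest-ranked point. -/
theorem cum_gapsOf (σ : Fin 4 → Equiv.Perm (Fin (q + 2))) (ε : ℝ) (w : Fin (q + 2) → Fin 4 → ℝ) (μ : Fin 4) :
    ∀ p : ℕ, (hp : p ≤ q + 1) → cum ε (gapsOf σ ε w) μ p = w (σ μ ⟨p, by omega⟩) μ - w (σ μ 0) μ := by
  intro p hp
  induction p with
  | zero => simp
  | succ p ih =>
      have hp' : p < q + 1 := by omega
      have h := cum_succ ε (gapsOf σ ε w) μ ⟨p, hp'⟩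
      simp only at h
      rw [h, ih hp'.le, gapsOf_gidx]
      have e1 : (Fin.castSucc (⟨p, hp'⟩ : Fin (q + 1)) : Fin (q + 2)) = ⟨p, by omega⟩ := Fin.ext rfl
      have e2 : ((⟨p, hp'⟩ : Fin (q + 1)).succ : Fin (q + 2)) = ⟨p + 1, by omega⟩ := Fin.ext rfl
      rw [e1, e2]
      ring

/-- **The configuration of its own gaps is the configuration, up to a translation**:
`conf ε σ (gapsOf σ ε w) i = toE w i − (lowest coordinates)`. -/
theorem conf_gapsOf (σ : Fin 4 → Equiv.Perm (Fin (q + 2))) (ε : ℝ) (w : Fin (q + 2) → Fin 4 → ℝ) (i : Fin (q + 2)) :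
    conf ε σ (gapsOf σ ε w) i = toE w i - WithLp.toLp 2 (fun μ => w (σ μ 0) μ) := by
  ext μ
  rw [conf_apply, cum_gapsOf σ ε w μ _ (by omega), PiLp.sub_apply, toE_apply]
  have : (⟨((σ μ).symm i : ℕ), by omega⟩ : Fin (q + 2)) = (σ μ).symm i := Fin.ext rfl
  rw [this, Equiv.apply_symm_apply]

/-- **Positive gaps separate the points along every axis**: if all gaps (minus `ε ≥ 0`) are non-negative, two
distinct points differ by at least `ε` in every coordinate. -/
theorem le_abs_sub_of_gapsOf_nonneg (σ : Fin 4 → Equiv.Perm (Fin (q + 2))) {ε : ℝ} (hε : 0 ≤ ε)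
    {w : Fin (q + 2) → Fin 4 → ℝ} (hw : ∀ j, 0 ≤ gapsOf σ ε w j) {i i' : Fin (q + 2)} (hii' : i ≠ i') (μ : Fin 4) :
    ε ≤ |w i μ - w i' μ| := by
  have h := le_abs_conf_sub_conf hε σ hw hii' μ
  rwa [conf_gapsOf, conf_gapsOf, PiLp.sub_apply, PiLp.sub_apply, toE_apply, toE_apply, sub_sub_sub_cancel_right] at h

/-- Hence the configuration is `r`-separated for `2r < ε`. -/
theorem sepCenters_toE_of_gapsOf_nonneg (σ : Fin 4 → Equiv.Perm (Fin (q + 2))) {ε r : ℝ} (hε : 0 ≤ ε)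
    (hr : 2 * r < ε) {w : Fin (q + 2) → Fin 4 → ℝ} (hw : ∀ j, 0 ≤ gapsOf σ ε w j) : SepCenters r (toE w) := by
  intro i i' hii'
  have h1 := le_abs_sub_of_gapsOf_nonneg σ hε hw hii' 0
  have h2 := abs_apply_zero_sub_le (toE w i) (toE w i')
  rw [toE_apply, toE_apply] at h2
  linarith

/-! ### Complexified gaps and rotations -/

/-- The complexified gaps (the same affine formula on complex coordinate arrays). -/
def gapsOfC (σ : Fin 4 → Equiv.Perm (Fin (q + 2))) (ε : ℝ) (w : Fin (q + 2) → Fin 4 → ℂ) (j : Fin (4 * q + 3 + 1)) : ℂ :=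
  w (σ (gapEquiv q j).1 (gapEquiv q j).2.succ) (gapEquiv q j).1 -
    w (σ (gapEquiv q j).1 (Fin.castSucc (gapEquiv q j).2)) (gapEquiv q j).1 - ε

/-- The complexified gaps at real points are the real gaps. -/
theorem gapsOfC_ofReal (σ : Fin 4 → Equiv.Perm (Fin (q + 2))) (ε : ℝ) (w : Fin (q + 2) → Fin 4 → ℝ) :
    gapsOfC σ ε (fun i μ => ((w i μ : ℝ) : ℂ)) = fun j => ((gapsOf σ ε w j : ℝ) : ℂ) := by
  funext j
  simp only [gapsOfC, gapsOf]
  push_cast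
  ring

/-- The complexified gaps are holomorphic (affine). -/
theorem differentiable_gapsOfC (σ : Fin 4 → Equiv.Perm (Fin (q + 2))) (ε : ℝ) :
    Differentiable ℂ fun w : Fin (q + 2) → Fin 4 → ℂ => gapsOfC σ ε w := by
  refine differentiable_pi.2 fun j => ?_
  simp only [gapsOfC]
  fun_prop

/-- Continuity of the complexified gaps. -/
theorem continuous_gapsOfC (σ : Fin 4 → Equiv.Perm (Fin (q + 2))) (ε : ℝ) :
    Continuous fun w : Fin (q + 2) → Fin 4 → ℂ => gapsOfC σ ε w :=
  (differentiable_gapsOfC σ ε).continuous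

/-- **The complexified action of a linear isometry on coordinate arrays** (through its real matrix). -/
def rotC (R : EuclideanSpace ℝ (Fin 4) ≃ₗᵢ[ℝ] EuclideanSpace ℝ (Fin 4)) (w : Fin (q + 2) → Fin 4 → ℂ)
    (i : Fin (q + 2)) (μ : Fin 4) : ℂ :=
  ∑ ν : Fin 4, ((R (EuclideanSpace.single ν (1 : ℝ)) μ : ℝ) : ℂ) * w i ν

/-- Coordinates of the image under a linear map of `ℝ⁴`, through the matrix. -/
theorem apply_eq_sum_single (R : EuclideanSpace ℝ (Fin 4) ≃ₗᵢ[ℝ] EuclideanSpace ℝ (Fin 4)) (x : EuclideanSpace ℝ (Fin 4))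
    (μ : Fin 4) : R x μ = ∑ ν : Fin 4, R (EuclideanSpace.single ν (1 : ℝ)) μ * x ν := by
  have hx : x = ∑ ν : Fin 4, x ν • EuclideanSpace.single ν (1 : ℝ) := by
    conv_lhs => rw [← (EuclideanSpace.basisFun (Fin 4) ℝ).sum_repr x]
    simp [EuclideanSpace.basisFun_apply, EuclideanSpace.basisFun_repr]
  conv_lhs => rw [hx]
  rw [map_sum]
  simp only [map_smul, WithLp.ofLp_sum, Finset.sum_apply, WithLp.ofLp_smul, Pi.smul_apply, smul_eq_mul]
  exact Finset.sum_congr rfl fun ν _ => mul_comm _ _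

/-- The complexified rotation at real points is the rotation. -/
theorem rotC_ofReal (R : EuclideanSpace ℝ (Fin 4) ≃ₗᵢ[ℝ] EuclideanSpace ℝ (Fin 4)) (w : Fin (q + 2) → Fin 4 → ℝ) :
    rotC R (fun i μ => ((w i μ : ℝ) : ℂ)) = fun i μ => (((R (toE w i)) μ : ℝ) : ℂ) := by
  funext i μ
  rw [rotC, apply_eq_sum_single]
  push_cast
  rfl

/-- The complexified rotation is holomorphic (linear). -/
theorem differentiable_rotC (R : EuclideanSpace ℝ (Fin 4) ≃ₗᵢ[ℝ] EuclideanSpace ℝ (Fin 4)) :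
    Differentiable ℂ fun w : Fin (q + 2) → Fin 4 → ℂ => rotC R w := by
  refine differentiable_pi.2 fun i => differentiable_pi.2 fun μ => ?_
  simp only [rotC]
  fun_prop

end Summit.QuantumFields.YangMills.Theorems.OSLegsAtWeakCouplingC.Loc

end
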